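import Literature.NumberTheory.Transcendental.ManyCurveSemistable
import Literature.NumberTheory.Transcendental.TorsionOrbit
import HarnessLib

/-!
# `k`-lattice standard models `M = 𝔾ₘ^β × P`: the Lie presentation (first layer of the family port)

Topic `Literature/NumberTheory/Transcendental`; third file of the unit
`provefact-Literature.NumberTheory.Transcendental.H-0a3eb64689` (fact
`Literature.NumberTheory.Transcendental.HuberWustholzManyCurvePeriods`, `ManyCurvePeriods.lean`:
for pairwise non-isogenous lattices `Λ₁, …, Λ_k` with algebraic invariants, CM allowed, every
`ℚ̄`-relation among `1, 2πi, ωⱼ⁽ⁱ⁾, ηⱼ⁽ⁱ⁾` splits — Huber–Wüstholz, *Transcendence and Linear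
Relations of 1-Periods*, Cambridge Tracts 227 (2022), Thm. 15.3 (1), `δ = 2 + ∑ 4/e(Eᵢ)`), after
`ManyCurveSemistable.lean`. It introduces NO named fact. It is the family counterpart of the
first layer of the one-lattice `SemistableQuotients.lean` / `SemistableTorsion.lean` (the
explicit models `M_κ`, points with torsion abelian part) and of the two-lattice `TwoCurveStd.lean`
(up to its `presTors`), for the

  **family standard models `M = 𝔾ₘ^β × P`**, `P` the push-out of the universal vectorial
  extension `0 → 𝔾ₐ^γ → ∏_{b ∈ γ} E_{cls b}♮ → ∏_b E_{cls b} → 0` along a `ℚ̄`-linear map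
  `κ : ℚ̄^γ → ℚ̄^δ`

(`L : J → PeriodPair` a finite family of lattices with algebraic invariants — the isotypic classes
— and `cls : γ → J` the class of each block; `E_i : y² = 4x³ − g₂(Λᵢ)x − g₃(Λᵢ)` over `ℚ̄`), with
Lie coordinates `(y'_j; z'_b; s_e)`, `j ∈ β`, `b ∈ γ`, `e ∈ δ` — literally the one-lattice
coordinates `GaGmE.Std.coords`, so that `iy, iz, is`, `yForm, zForm, sForm` and
`GaGmE.Std.SubgroupData.tangent` are reused verbatim. These are the group varieties met by an
induction over quotients and subgroups (Baker–Wüstholz 2007, §6.8, p. 115) starting from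
`𝔾ₐ × 𝔾ₘ^ι × ∏_b E_{cls b}♮` (`GaGmEFam.pres`, `ManyCurveSemistable.lean`).

## What is proved here (everything; no `sorry`, no new `def … : Prop`)

* `GaGmEFam.Std.SubgroupData` — the connected algebraic subgroups `H_{(A,C,Ξ)}` of `M` for
  pairwise non-isogenous classes whose CM classes carry at most one block: characters `A ≤ ℚ^β`,
  a BLOCK-DIAGONAL space `C ≤ ℚ^γ` of rational homomorphisms (`GaGmEFam.IsBlockDiag cls C`: the
  abelian part is a product `∏_i B̃_i` of isotypic pieces, `Hom(E_i, E_j) = 0`;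
  classification in the module docstring of `ManyCurveSemistable.lean`, with the push-out `P` in
  place of `∏_b E_{cls b}♮`: Baker–Wüstholz 2007, Prop. 4.3, Lemma 4.4, proof of Thm. 6.2;
  Huber–Wüstholz 2022, Prop. 4.18–4.20; Brion 2009, Prop. 3.3), additive characters `Ξ ≤ ℚ̄^δ`
  with `ξ ∘ κ ∈ span_ℚ̄ C`; `toOne`, `tangent`, `top/bot`, `tangent_top/bot`, `tangent_eq_top`,
  `isKRational_tangent`;
* `GaGmEFam.Std.ker` (`(2πiℤ)^β × {(z', κ η(z')) : z'_b ∈ Λ_{cls b}}`), `Alg`, `AlgTors` (torsion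
  abelian part), `algLie`, `Semistable` (Baker–Wüstholz 2007, §6.7), `kerSubgroup`;
* `torsion_mem_Alg(Tors)` (division points of period vectors,
  `PeriodPair.IsUnivExtAlgPoint.inv_natCast_mul_of_isTorsionPt` block by block, each block with
  the invariants of its own class), `inv_natCast_smul_mem_AlgTors` (`AlgTors` is stable under
  division), `SubgroupData.mem_tangent_of_forall_exists` (discreteness of `ker(exp_{M/K₀})`, class
  by class: a form of `C` supported in ONE class takes values in the discrete group `Λ_i` on `ker`
  — the one place where block-diagonality, i.e. non-isogeny, is used; `GaGmEFam.forall_of_blocks`),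
  and the Lie presentation `GaGmEFam.Std.presTors` with its four axioms PROVED.

## What remains (next layers of the port, as in `TwoCurveStd.lean` §§ Quot ff.)

`QuotData` (quotients `M/K₀` are again family standard models: unimodular integer bases of
`C₀ ∩ ℤ^γ` CLASS BY CLASS, new block index `Σ i, Fin nᵢ` with class map `Sigma.fst`),
`transport`, `semistable_of_hyperplane`, `hyperplaneTheorem_presTors_of_std_torsHyperplane`, and
`HuberWustholzManyCurvePeriods_of_std_tors` — the fact from Baker–Wüstholz's Thm. 6.15 for the
family standard models at points with torsion abelian part; then Baker's method on `M`
(`TwoCurveInduction` … `TwoCurveClosing` with the lattice of the block `b` equal to `Λ_{cls b}`).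

## References

* A. Baker, G. Wüstholz, *Logarithmic Forms and Diophantine Geometry*, New Math. Monogr. 9, CUP
  2007: Thm. 6.1, Thm. 6.15, §6.7 (index, semistability), §6.8 (p. 115: passage to quotients;
  p. 117: division points). [BakerWustholz2007]
* A. Huber, G. Wüstholz, *Transcendence and Linear Relations of 1-Periods*, Cambridge Tracts 227,
  CUP 2022: Thm. 15.3 (1) (p. 145), Thm. 6.2, Prop. 4.18–4.20, §18.1. [HuberWustholz2022]
* M. Brion, *Anti-affine algebraic groups*, J. Algebra 321 (2009), Prop. 3.3. [Brion2009]
-/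

noncomputable section

open Complex Module Submodule

namespace Literature.NumberTheory.Transcendental

namespace GaGmEFam

namespace Std

open GaGmE (Kbar isAlgebraic_cexp_rat_mul int_eq_zero_of_forall_dvd coords_eq_zero_of_forall
  exists_common_den)
open GaGmE.Std (iy iz is coords coords_iy coords_iz coords_is sum_blocks)

variable {J : Type} [DecidableEq J] {β γ δ : Type}

/-! ### Connected algebraic subgroups of the family standard models -/

section Subgroups

variable [Fintype β] [Fintype γ] [Fintype δ]

/-- **Connected algebraic subgroups of `M = 𝔾ₘ^β × P`**, `P` the push-out of the universal
vectorial extension of `∏_b E_{cls b}` along `κ : ℚ̄^γ → ℚ̄^δ` (classes pairwise non-isogenous,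
CM classes with at most one block), in dual form: rational characters `A ≤ ℚ^β` of the torus, a
block-diagonal space `C ≤ ℚ^γ` of rational homomorphisms cutting out the abelian part
`∏_i B̃_i`, additive characters `Ξ ≤ ℚ̄^δ` of the vector part, with the compatibility
`ξ ∘ κ ∈ span_ℚ̄ C`. The one-lattice `GaGmE.Std.SubgroupData` on the block index `γ` whose `C`
is block-diagonal (`toOne`). [folklore] -/
structure SubgroupData {J : Type} [DecidableEq J] (β γ δ : Type) [Fintype β] [Fintype γ]
    [Fintype δ] (cls : γ → J) (κM : δ → γ → Kbar) where
  /-- Rational characters of `𝔾ₘ^β` killing `Lie H`. -/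
  A : Submodule ℚ (β → ℚ)
  /-- Rational homomorphisms `∏_b E_{cls b} → E_i` killing the abelian part of `H`. -/
  C : Submodule ℚ (γ → ℚ)
  /-- `C` is block-diagonal along the classes. -/
  blockDiag : IsBlockDiag cls C
  /-- Additive characters of the vector part `𝔾ₐ^δ` killing the vector part of `H`. -/
  Ξ : Submodule Kbar (δ → Kbar)
  /-- Compatibility: `ξ ∘ κ ∈ span C` for `ξ ∈ Ξ`. -/
  compat : ∀ ξ ∈ Ξ, (fun b => ∑ e, ξ e * κM e b) ∈
    Submodule.span Kbar ((fun c : γ → ℚ => fun b => (c b : Kbar)) '' (C : Set (γ → ℚ)))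

namespace SubgroupData

variable {cls : γ → J} {κM : δ → γ → Kbar}

/-- The same data as one-lattice-shaped data on the block index `γ`. [folklore] -/
def toOne (D : SubgroupData β γ δ cls κM) : GaGmE.Std.SubgroupData β γ δ κM where
  A := D.A
  C := D.C
  Ξ := D.Ξ
  compat := D.compat

/-- **The Lie algebra `Lie H_ℂ ⊆ Lie M_ℂ = ℂ^{β ⊕ (γ ⊕ δ)}`** of `H_{(A,C,Ξ)}`. [folklore] -/
def tangent (D : SubgroupData β γ δ cls κM) : Submodule ℂ (β ⊕ (γ ⊕ δ) → ℂ) :=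
  D.toOne.tangent

/-- Membership in `Lie H`. [folklore] -/
theorem mem_tangent_iff (D : SubgroupData β γ δ cls κM) (w : β ⊕ (γ ⊕ δ) → ℂ) :
    w ∈ D.tangent ↔ (∀ q ∈ D.A, ∑ j, (q j : ℂ) * w (iy j) = 0) ∧
      (∀ c ∈ D.C, ∑ b, (c b : ℂ) * w (iz b) = 0) ∧
        ∀ ξ ∈ D.Ξ, ∑ e, (ξ e : ℂ) * w (is e) = 0 :=
  GaGmE.Std.SubgroupData.mem_tangent_iff D.toOne w

/-- `Lie H` is `ℚ̄`-rational. [folklore] -/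
theorem isKRational_tangent (D : SubgroupData β γ δ cls κM) :
    LiePresentation.IsKRational Kbar D.tangent :=
  LiePresentation.isKRational_solSpace Kbar D.toOne.forms

variable (cls κM) in
/-- The whole group `M` (`A = 0`, `C = 0`, `Ξ = 0`). [folklore] -/
def top : SubgroupData β γ δ cls κM where
  A := ⊥
  C := ⊥
  blockDiag := isBlockDiag_bot cls
  Ξ := ⊥
  compat := by
    intro ξ hξ
    rw [Submodule.mem_bot] at hξ
    subst hξ
    have : (fun b => ∑ e, (0 : δ → Kbar) e * κM e b) = 0 := by funext b; simp
    rw [this]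
    exact Submodule.zero_mem _

variable (cls κM) in
/-- The trivial subgroup (`A`, `C`, `Ξ` everything). [folklore] -/
def bot : SubgroupData β γ δ cls κM where
  A := ⊤
  C := ⊤
  blockDiag := isBlockDiag_top cls
  Ξ := ⊤
  compat := by
    classical
    intro ξ _
    set f : γ → Kbar := fun b => ∑ e, ξ e * κM e b
    have : f = ∑ b, f b • (fun b' => ((Pi.single b 1 : γ → ℚ) b' : Kbar)) := by
      funext b'
      simp only [Finset.sum_apply, Pi.smul_apply, smul_eq_mul, Pi.single_apply]
      rw [Finset.sum_eq_single b']
      · simp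
      · intro b _ hb; simp [Ne.symm hb]
      · intro h; exact absurd (Finset.mem_univ _) h
    rw [this]
    refine Submodule.sum_mem _ fun b _ => Submodule.smul_mem _ _ (Submodule.subset_span ?_)
    exact ⟨Pi.single b 1, Submodule.mem_top, rfl⟩

/-- If `A = 0`, `C = 0` and `Ξ = 0` then `Lie H = Lie M`. [folklore] -/
theorem tangent_eq_top {D : SubgroupData β γ δ cls κM} (hA : D.A = ⊥) (hC : D.C = ⊥)
    (hΞ : D.Ξ = ⊥) : D.tangent = ⊤ := by
  rw [eq_top_iff]
  intro w _
  rw [mem_tangent_iff]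
  refine ⟨fun q hq => ?_, fun c hc => ?_, fun ξ hξ => ?_⟩
  · rw [hA, Submodule.mem_bot] at hq; subst hq; simp
  · rw [hC, Submodule.mem_bot] at hc; subst hc; simp
  · rw [hΞ, Submodule.mem_bot] at hξ; subst hξ; simp

/-- `Lie M = ⊤`. [folklore] -/
theorem tangent_top : (top cls κM : SubgroupData β γ δ cls κM).tangent = ⊤ :=
  tangent_eq_top rfl rfl rfl

/-- `Lie 0 = ⊥`. [folklore] -/
theorem tangent_bot : (bot cls κM : SubgroupData β γ δ cls κM).tangent = ⊥ := by
  classical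
  rw [eq_bot_iff]
  intro w hw
  rw [mem_tangent_iff] at hw
  obtain ⟨hA, hC, hΞ⟩ := hw
  rw [Submodule.mem_bot]
  funext s
  rcases s with j | b | e
  · have := hA (Pi.single j 1) Submodule.mem_top
    show w (iy j) = 0
    rw [Finset.sum_eq_single j (fun x _ hx => by simp [Pi.single_eq_of_ne hx])
      (fun h => absurd (Finset.mem_univ j) h)] at this
    simpa using this
  · have := hC (Pi.single b 1) Submodule.mem_top
    show w (iz b) = 0
    rw [Finset.sum_eq_single b (fun x _ hx => by simp [Pi.single_eq_of_ne hx])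
      (fun h => absurd (Finset.mem_univ b) h)] at this
    simpa using this
  · have := hΞ (Pi.single e 1) Submodule.mem_top
    show w (is e) = 0
    rw [Finset.sum_eq_single e (fun x _ hx => by simp [Pi.single_eq_of_ne hx])
      (fun h => absurd (Finset.mem_univ e) h)] at this
    simpa using this

end SubgroupData

/-! ### Kernel, algebraic points, semistability -/

variable (L : J → PeriodPair) (cls : γ → J) (κM : δ → γ → Kbar)

/-- `ker(exp_M) = (2πiℤ)^β × {(z', κ η(z')) : z'_b ∈ Λ_{cls b}}` — on the block `b` the lattice
is `Λ_{cls b}`, with the quasi-period map `η` of that lattice. [folklore] -/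
def ker : Set (β ⊕ (γ ⊕ δ) → ℂ) :=
  {w | (∀ j, ∃ p : ℤ, w (iy j) = p * (2 * Real.pi * I)) ∧
    ∃ m n : γ → ℤ, (∀ b, w (iz b) = m b * (L (cls b)).ω₁ + n b * (L (cls b)).ω₂) ∧
      ∀ e, w (is e) = ∑ b, (κM e b : ℂ) * (m b * (L (cls b)).η₁ + n b * (L (cls b)).η₂)}

/-- `exp_M⁻¹(M(ℚ̄))`: `e^{y'_j} ∈ ℚ̄`, and some representative `(z', t', s'')` of `(z', s)`,
`s = s'' + κ t'`, has `(z'_b, t'_b)` a `ℚ̄`-point of `E_{cls b}♮` and `s'' ∈ ℚ̄^δ`. [folklore] -/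
def Alg : Set (β ⊕ (γ ⊕ δ) → ℂ) :=
  {w | (∀ j, IsAlgebraic ℚ (cexp (w (iy j)))) ∧
    ∃ t' : γ → ℂ, (∀ b, (L (cls b)).IsUnivExtAlgPoint (w (iz b)) (t' b)) ∧
      ∀ e, IsAlgebraic ℚ (w (is e) - ∑ b, (κM e b : ℂ) * t' b)}

/-- `exp_M⁻¹` of the algebraic points of `M` whose image in `∏_b E_{cls b}` is **torsion**.
[folklore] -/
def AlgTors : Set (β ⊕ (γ ⊕ δ) → ℂ) :=
  {w | w ∈ Alg L cls κM ∧ ∀ b, (L (cls b)).IsTorsionPt (w (iz b))}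

/-- The Lie algebras of the connected algebraic subgroups of `M`. [folklore] -/
def algLie : Set (Submodule ℂ (β ⊕ (γ ⊕ δ) → ℂ)) :=
  Set.range fun D : SubgroupData β γ δ cls κM => D.tangent

/-- Semistability of `𝔟 ⊆ Lie M` in `M` (Baker–Wüstholz 2007, §6.7):
`dim 𝔟 / dim M ≤ (dim 𝔟 - dim(𝔟 ∩ 𝔨)) / (dim M - dim 𝔨)` for all `𝔨 = Lie K`, `K ≠ M` connected
algebraic. [cite: BakerWustholz2007, §6.7 (index and semistability)] -/
def Semistable (𝔟 : Submodule ℂ (β ⊕ (γ ⊕ δ) → ℂ)) : Prop :=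
  ∀ 𝔨 ∈ algLie cls κM, 𝔨 ≠ ⊤ →
    finrank ℂ 𝔟 * (Fintype.card (β ⊕ (γ ⊕ δ)) - finrank ℂ 𝔨) ≤
      (finrank ℂ 𝔟 - finrank ℂ ↥(𝔟 ⊓ 𝔨)) * Fintype.card (β ⊕ (γ ⊕ δ))

variable {L cls κM}

omit [DecidableEq J] [Fintype β] [Fintype δ] in
/-- `AlgTors ⊆ Alg`. [folklore] -/
theorem algTors_subset_alg : AlgTors (β := β) L cls κM ⊆ Alg L cls κM := fun _ h => h.1

end Subgroups

/-! ### Torsion points, division points, the kernel as a subgroup -/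

section Points

variable [Fintype γ] {L : J → PeriodPair} {cls : γ → J} {κM : δ → γ → Kbar}

omit [DecidableEq J] in
/-- **Torsion points of `M` are algebraic**: `k/m ∈ Alg` for `k ∈ ker(exp_M)` — roots of unity
in `𝔾ₘ^β`, the `m`-division points of the period vectors of the `E_{cls b}♮`
(`PeriodPair.IsUnivExtAlgPoint.inv_natCast_mul_of_isTorsionPt`), and `s/m - κ(η/m) = 0`.
[folklore] -/
theorem torsion_mem_Alg (hL : ∀ i, IsAlgebraic ℚ (L i).g₂ ∧ IsAlgebraic ℚ (L i).g₃)
    {w : β ⊕ (γ ⊕ δ) → ℂ} (hw : w ∈ ker L cls κM) {m : ℕ} (hm : 0 < m) :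
    ((m : ℂ)⁻¹ • w) ∈ Alg L cls κM := by
  obtain ⟨hy, a, a', hz, hs⟩ := hw
  refine ⟨fun j => ?_,
    fun b => (m : ℂ)⁻¹ * (a b * (L (cls b)).η₁ + a' b * (L (cls b)).η₂),
    fun b => ?_, fun e => ?_⟩
  · obtain ⟨p, hp⟩ := hy j
    simp only [Pi.smul_apply, smul_eq_mul, hp]
    exact isAlgebraic_cexp_rat_mul hm
  · simp only [Pi.smul_apply, smul_eq_mul, hz b]
    exact ((L (cls b)).isUnivExtAlgPoint_period (a b) (a' b)).inv_natCast_mul_of_isTorsionPt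
      (hL (cls b)).1 (hL (cls b)).2 ((L (cls b)).isTorsionPt_period (a b) (a' b)) hm
  · simp only [Pi.smul_apply, smul_eq_mul, hs e]
    have : (m : ℂ)⁻¹ * ∑ b, (κM e b : ℂ) * (a b * (L (cls b)).η₁ + a' b * (L (cls b)).η₂) -
        ∑ b, (κM e b : ℂ) * ((m : ℂ)⁻¹ * (a b * (L (cls b)).η₁ + a' b * (L (cls b)).η₂)) = 0 := by
      rw [Finset.mul_sum, ← Finset.sum_sub_distrib]
      exact Finset.sum_eq_zero fun _ _ => by ring
    rw [this]
    exact isAlgebraic_zero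

omit [DecidableEq J] in
/-- Torsion points of `M` lie in `AlgTors`. [folklore] -/
theorem torsion_mem_AlgTors (hL : ∀ i, IsAlgebraic ℚ (L i).g₂ ∧ IsAlgebraic ℚ (L i).g₃)
    {w : β ⊕ (γ ⊕ δ) → ℂ} (hw : w ∈ ker L cls κM) {m : ℕ} (hm : 0 < m) :
    ((m : ℂ)⁻¹ • w) ∈ AlgTors L cls κM := by
  refine ⟨torsion_mem_Alg hL hw hm, fun b => ?_⟩
  obtain ⟨-, a, a', hz, -⟩ := hw
  simp only [Pi.smul_apply, smul_eq_mul, hz b]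
  exact ((L (cls b)).isTorsionPt_period (a b) (a' b)).inv_natCast_mul hm

omit [DecidableEq J] in
/-- **`AlgTors` is stable under division**: `w ∈ AlgTors ⇒ w/m ∈ AlgTors` (`m ≥ 1`), block by
block by `PeriodPair.IsUnivExtAlgPoint.inv_natCast_mul_of_isTorsionPt`.
[cite: BakerWustholz2007, §6.8 (p. 117: "The coordinates of γ are contained in an extension 𝕂_ℓ of 𝕂")] -/
theorem inv_natCast_smul_mem_AlgTors (hL : ∀ i, IsAlgebraic ℚ (L i).g₂ ∧ IsAlgebraic ℚ (L i).g₃)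
    {w : β ⊕ (γ ⊕ δ) → ℂ} (hw : w ∈ AlgTors L cls κM) {m : ℕ} (hm : 0 < m) :
    ((m : ℂ)⁻¹ • w) ∈ AlgTors L cls κM := by
  obtain ⟨⟨hy, t', hzt, hs⟩, htor⟩ := hw
  have hminv : IsAlgebraic ℚ ((m : ℂ)⁻¹) := (isAlgebraic_nat m).inv
  refine ⟨⟨fun j => ?_, fun b => (m : ℂ)⁻¹ * t' b, fun b => ?_, fun e => ?_⟩, fun b => ?_⟩
  · refine IsAlgebraic.of_pow hm ?_
    have e : cexp (((m : ℂ)⁻¹ • w) (iy j)) ^ m = cexp (w (iy j)) := by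
      rw [← Complex.exp_nat_mul]
      simp only [Pi.smul_apply, smul_eq_mul]
      congr 1
      field_simp [(show (m : ℂ) ≠ 0 by exact_mod_cast hm.ne')]
    rw [e]; exact hy j
  · exact (hzt b).inv_natCast_mul_of_isTorsionPt (hL (cls b)).1 (hL (cls b)).2 (htor b) hm
  · have e1 : ((m : ℂ)⁻¹ • w) (is e) - ∑ b, (κM e b : ℂ) * ((m : ℂ)⁻¹ * t' b) =
        (m : ℂ)⁻¹ * (w (is e) - ∑ b, (κM e b : ℂ) * t' b) := by
      simp only [Pi.smul_apply, smul_eq_mul, Finset.mul_sum, mul_sub]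
      congr 1
      exact Finset.sum_congr rfl fun b _ => by ring
    rw [e1]; exact hminv.mul (hs e)
  · simpa only [Pi.smul_apply, smul_eq_mul] using (htor b).inv_natCast_mul hm

variable (L cls κM)

omit [DecidableEq J] in
/-- `0 ∈ ker`. [folklore] -/
theorem zero_mem_ker : (0 : β ⊕ (γ ⊕ δ) → ℂ) ∈ ker L cls κM :=
  ⟨fun _ => ⟨0, by simp⟩, 0, 0, fun _ => by simp, fun _ => by simp⟩

variable {L cls κM}

omit [DecidableEq J] in
/-- `ker` is closed under addition. [folklore] -/
theorem add_mem_ker {k k' : β ⊕ (γ ⊕ δ) → ℂ} (hk : k ∈ ker L cls κM)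
    (hk' : k' ∈ ker L cls κM) : k + k' ∈ ker L cls κM := by
  obtain ⟨hy, m, n, hz, hs⟩ := hk
  obtain ⟨hy', m', n', hz', hs'⟩ := hk'
  refine ⟨fun j => ?_, m + m', n + n', fun b => ?_, fun e => ?_⟩
  · obtain ⟨p, hp⟩ := hy j
    obtain ⟨p', hp'⟩ := hy' j
    exact ⟨p + p', by simp only [Pi.add_apply, hp, hp']; push_cast; ring⟩
  · simp only [Pi.add_apply, hz b, hz' b]; push_cast; ring
  · simp only [Pi.add_apply, hs e, hs' e, ← Finset.sum_add_distrib]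
    refine Finset.sum_congr rfl fun b _ => ?_
    push_cast; ring

omit [DecidableEq J] in
/-- `ker` is closed under negation. [folklore] -/
theorem neg_mem_ker {k : β ⊕ (γ ⊕ δ) → ℂ} (hk : k ∈ ker L cls κM) : -k ∈ ker L cls κM := by
  obtain ⟨hy, m, n, hz, hs⟩ := hk
  refine ⟨fun j => ?_, -m, -n, fun b => ?_, fun e => ?_⟩
  · obtain ⟨p, hp⟩ := hy j
    exact ⟨-p, by simp only [Pi.neg_apply, hp]; push_cast; ring⟩
  · simp only [Pi.neg_apply, hz b]; push_cast; ring
  · simp only [Pi.neg_apply, hs e, ← Finset.sum_neg_distrib]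
    refine Finset.sum_congr rfl fun b _ => ?_
    push_cast; ring

variable (L cls κM)

/-- **`ker(exp_M)` as a subgroup of `Lie M_ℂ`.** [folklore] -/
def kerSubgroup : AddSubgroup (β ⊕ (γ ⊕ δ) → ℂ) where
  carrier := ker L cls κM
  zero_mem' := zero_mem_ker L cls κM
  add_mem' := add_mem_ker
  neg_mem' := neg_mem_ker

omit [DecidableEq J] in
/-- Membership in `kerSubgroup`. [folklore] -/
@[simp] theorem mem_kerSubgroup {w : β ⊕ (γ ⊕ δ) → ℂ} :
    w ∈ kerSubgroup L cls κM ↔ w ∈ ker L cls κM :=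
  Iff.rfl

omit [DecidableEq J] in
/-- Natural multiples of kernel vectors are kernel vectors. [folklore] -/
theorem natCast_smul_mem_ker {k : β ⊕ (γ ⊕ δ) → ℂ} (hk : k ∈ ker L cls κM) (r : ℕ) :
    (r : ℂ) • k ∈ ker L cls κM := by
  have : (r : ℂ) • k = r • k := (Nat.cast_smul_eq_nsmul ℂ r k)
  rw [this, ← mem_kerSubgroup]
  exact AddSubgroup.nsmul_mem _ hk r

end Points

/-! ### Discreteness of `ker(exp_{M/K})` -/

section Discrete

variable [Fintype J] [Fintype β] [Fintype γ] [Fintype δ] {L : J → PeriodPair} {cls : γ → J}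
  {κM : δ → γ → Kbar}

/-- **Discreteness of `ker(exp_{M/K₀})`.** If `v ∈ m · (ker(exp_M) + Lie K₀)` for every `m ≥ 1`,
then `v ∈ Lie K₀`: the characters in `A` take values in `2πiℤ` on `ker`, the homomorphisms of `C`
supported in ONE class `i` take values in the discrete group `Λ_i` (this is where the
block-diagonal shape — non-isogeny — is used: a mixed form would take values in `Λ_i + Λ_j`,
which need not be discrete; every `c ∈ C` is the sum of its class restrictions, all in `C`), and
the additive characters in `Ξ` vanish on the relevant quasi-periods by the compatibility
`ξ ∘ κ ∈ span C`. [folklore] -/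
theorem SubgroupData.mem_tangent_of_forall_exists (D : SubgroupData β γ δ cls κM)
    (v : β ⊕ (γ ⊕ δ) → ℂ)
    (hv : ∀ m : ℕ, 0 < m → ∃ k ∈ ker L cls κM, ∃ h ∈ D.tangent, v = (m : ℂ) • (k + h)) :
    v ∈ D.tangent := by
  classical
  rw [SubgroupData.mem_tangent_iff]
  -- the class-supported `z`-forms vanish on `v`
  have hCblk : ∀ c ∈ D.C, ∀ L₀ : PeriodPair, (∀ b, c b ≠ 0 → L (cls b) = L₀) →
      ∑ b, (c b : ℂ) * v (iz b) = 0 := by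
    intro c hc L₀ hblk
    obtain ⟨d, hd, n, hn⟩ := exists_common_den c
    have hn' : ∀ b, (d : ℂ) * (c b : ℂ) = (n b : ℂ) := fun b => by
      have := congrArg (fun r : ℚ => (r : ℂ)) (hn b)
      push_cast at this
      exact this
    have hnblk : ∀ b, n b ≠ 0 → L (cls b) = L₀ := fun b hb => hblk b (by
      intro hcb
      apply hb
      have := hn b
      rw [hcb, mul_zero] at this
      exact_mod_cast this.symm)
    set S : ℂ := ∑ b, (c b : ℂ) * v (iz b) with hS
    have hm : ∀ m : ℕ, 0 < m → ∃ P' Q' : ℤ,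
        (d : ℂ) * S = (m : ℂ) * (P' * L₀.ω₁ + Q' * L₀.ω₂) := by
      intro m hm
      obtain ⟨kv, hkv, h, hh, hvm⟩ := hv m hm
      obtain ⟨-, a, a', hab, -⟩ := hkv
      have hh' := ((SubgroupData.mem_tangent_iff D h).mp hh).2.1 c hc
      refine ⟨∑ b, n b * a b, ∑ b, n b * a' b, ?_⟩
      have e1 : (d : ℂ) * S = (m : ℂ) * (∑ b, (n b : ℂ) * kv (iz b)) +
          (m : ℂ) * (d : ℂ) * ∑ b, (c b : ℂ) * h (iz b) := by
        rw [hS, hvm]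
        simp only [Pi.smul_apply, Pi.add_apply, smul_eq_mul, Finset.mul_sum]
        rw [← Finset.sum_add_distrib]
        refine Finset.sum_congr rfl fun b _ => ?_
        rw [← hn' b]; ring
      rw [e1, hh', mul_zero, add_zero]
      congr 1
      have e2 : ∑ b, (n b : ℂ) * kv (iz b) =
          ∑ b, ((n b : ℚ) : ℂ) * (a b * (L (cls b)).ω₁ + a' b * (L (cls b)).ω₂) :=
        Finset.sum_congr rfl fun b _ => by rw [hab b]; push_cast; ring
      rw [e2, sum_mul_periods_eq (fun b hb => hnblk b (by exact_mod_cast hb)) a a']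
      push_cast; ring
    obtain ⟨P₁, Q₁, e₁⟩ := hm 1 one_pos
    rw [Nat.cast_one, one_mul] at e₁
    have hPQ : P₁ = 0 ∧ Q₁ = 0 := by
      refine coords_eq_zero_of_forall (L := L₀) fun m hm' => ?_
      obtain ⟨P', Q', e⟩ := hm m hm'
      exact ⟨P', Q', by rw [← e₁, e]⟩
    obtain ⟨rfl, rfl⟩ := hPQ
    have : (d : ℂ) * S = 0 := by rw [e₁]; simp
    exact (mul_eq_zero.mp this).resolve_left (by exact_mod_cast hd.ne')
  have hC : ∀ c ∈ D.C, ∑ b, (c b : ℂ) * v (iz b) = 0 :=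
    forall_of_blocks (L := L) D.blockDiag hCblk
  refine ⟨fun q hq => ?_, hC, fun ξ hξ => ?_⟩
  · -- the `y'`-forms: values in `2πi ℤ`
    obtain ⟨d, hd, n, hn⟩ := exists_common_den q
    set S : ℂ := ∑ i, (q i : ℂ) * v (iy i) with hS
    have hm : ∀ m : ℕ, 0 < m → ∃ N : ℤ, (d : ℂ) * S = (m : ℂ) * (N * (2 * Real.pi * I)) := by
      intro m hm
      obtain ⟨kv, hkv, h, hh, hvm⟩ := hv m hm
      obtain ⟨hky, -⟩ := hkv
      choose p hp using hky
      have hh' := ((SubgroupData.mem_tangent_iff D h).mp hh).1 q hq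
      refine ⟨∑ i, n i * p i, ?_⟩
      have e1 : (d : ℂ) * S = (m : ℂ) * (∑ i, ((d : ℚ) * q i : ℚ) * kv (iy i)) +
          (m : ℂ) * (d : ℂ) * ∑ i, (q i : ℂ) * h (iy i) := by
        rw [hS, hvm]
        simp only [Pi.smul_apply, Pi.add_apply, smul_eq_mul, Finset.mul_sum]
        rw [← Finset.sum_add_distrib]
        refine Finset.sum_congr rfl fun i _ => ?_
        push_cast; ring
      rw [e1, hh', mul_zero, add_zero]
      congr 1
      push_cast
      rw [Finset.sum_mul]
      refine Finset.sum_congr rfl fun i _ => ?_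
      have hn' : (d : ℂ) * (q i : ℂ) = (n i : ℂ) := by
        have := congrArg (fun r : ℚ => (r : ℂ)) (hn i)
        push_cast at this
        exact this
      rw [hn', hp i]
      ring
    obtain ⟨N₁, e₁⟩ := hm 1 one_pos
    rw [Nat.cast_one, one_mul] at e₁
    have hN₁ : N₁ = 0 := by
      refine int_eq_zero_of_forall_dvd fun m hm' => ?_
      obtain ⟨N, e⟩ := hm m hm'
      rw [e₁] at e
      have h2 : (2 * Real.pi * I : ℂ) ≠ 0 := by simp [Real.pi_ne_zero, I_ne_zero]
      have : (N₁ : ℂ) = (m : ℂ) * N := by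
        have := mul_right_cancel₀ h2 (by rw [e]; ring : (N₁ : ℂ) * (2 * Real.pi * I) =
          ((m : ℂ) * N) * (2 * Real.pi * I))
        exact this
      exact ⟨N, by exact_mod_cast this⟩
    subst hN₁
    have : (d : ℂ) * S = 0 := by rw [e₁]; simp
    exact (mul_eq_zero.mp this).resolve_left (by exact_mod_cast hd.ne')
  · -- the `s`-forms: use `m = 1` and the compatibility
    obtain ⟨kv, hkv, h, hh, hv1⟩ := hv 1 one_pos
    rw [Nat.cast_one, one_smul] at hv1
    obtain ⟨-, a, a', hab, hks⟩ := hkv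
    obtain ⟨-, hhC, hhΞ⟩ := (SubgroupData.mem_tangent_iff D h).mp hh
    -- the `z`-forms of `C` vanish on the kernel vector `kv = v - h`
    have h3 : ∀ c ∈ D.C, ∑ b, (c b : ℂ) * kv (iz b) = 0 := by
      intro c hc
      have h1 := hC c hc
      have h2 := hhC c hc
      have : ∑ b, (c b : ℂ) * v (iz b) =
          ∑ b, (c b : ℂ) * kv (iz b) + ∑ b, (c b : ℂ) * h (iz b) := by
        rw [← Finset.sum_add_distrib]
        refine Finset.sum_congr rfl fun b _ => ?_
        rw [hv1]; simp only [Pi.add_apply]; ring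
      rw [h1, h2, add_zero] at this
      exact this.symm
    -- class-supported forms: integer relations `∑ c_b a_b = 0 = ∑ c_b a'_b`
    have hrel : ∀ c ∈ D.C, ∀ L₀ : PeriodPair, (∀ b, c b ≠ 0 → L (cls b) = L₀) →
        (∑ b, c b * a b : ℚ) = 0 ∧ (∑ b, c b * a' b : ℚ) = 0 := by
      intro c hc L₀ hblk
      have h4 := h3 c hc
      have e : ∑ b, (c b : ℂ) * kv (iz b) =
          ∑ b, (c b : ℂ) * (a b * (L (cls b)).ω₁ + a' b * (L (cls b)).ω₂) :=
        Finset.sum_congr rfl fun b _ => by rw [hab b]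
      rw [e, sum_mul_periods_eq hblk a a'] at h4
      have e' : ((((∑ b, c b * a b : ℚ) : ℝ)) : ℂ) * L₀.ω₁ +
          (((∑ b, c b * a' b : ℚ) : ℝ) : ℂ) * L₀.ω₂
          = ((0 : ℝ) : ℂ) * L₀.ω₁ + ((0 : ℝ) : ℂ) * L₀.ω₂ := by
        push_cast at h4 ⊢
        rw [h4]; simp
      obtain ⟨e1, e2⟩ := L₀.real_coords_unique e'
      exact ⟨by exact_mod_cast e1, by exact_mod_cast e2⟩
    -- hence the forms of `C` kill the quasi-period vector of `kv`
    have hη : ∀ c ∈ D.C,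
        ∑ b, (c b : ℂ) * (a b * (L (cls b)).η₁ + a' b * (L (cls b)).η₂) = 0 := by
      refine forall_of_blocks (L := L) D.blockDiag fun c hc L₀ hblk => ?_
      obtain ⟨r1, r2⟩ := hrel c hc L₀ hblk
      rw [sum_mul_quasiPeriods_eq hblk a a', r1, r2]
      simp
    -- and so does every `ℚ̄`-combination of them, in particular `ξ ∘ κ`
    have hkill : ∀ lam ∈ Submodule.span Kbar
        ((fun c : γ → ℚ => fun b => (c b : Kbar)) '' (D.C : Set (γ → ℚ))),
        ∑ b, ((lam b : Kbar) : ℂ) * (a b * (L (cls b)).η₁ + a' b * (L (cls b)).η₂) = 0 := by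
      intro lam hlam
      induction hlam using Submodule.span_induction with
      | mem x hx =>
        obtain ⟨c, hc, rfl⟩ := hx
        have := hη c hc
        dsimp only
        push_cast at this ⊢
        exact this
      | zero => simp
      | add x y _ _ hx hy =>
        simp only [Pi.add_apply]
        push_cast
        simp only [add_mul, Finset.sum_add_distrib, hx, hy, add_zero]
      | smul r x _ hx =>
        simp only [Pi.smul_apply, smul_eq_mul]
        push_cast
        simp only [mul_assoc, ← Finset.mul_sum, hx, mul_zero]
    have hξκ : ∑ b, ((∑ e, ξ e * κM e b : Kbar) : ℂ) *
        (a b * (L (cls b)).η₁ + a' b * (L (cls b)).η₂) = 0 :=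
      hkill _ (D.compat ξ hξ)
    have hpair_k : ∑ e, (ξ e : ℂ) * kv (is e) = 0 := by
      rw [← hξκ]
      simp only [hks]
      push_cast
      simp only [Finset.mul_sum, Finset.sum_mul]
      rw [Finset.sum_comm]
      exact Finset.sum_congr rfl fun b _ => Finset.sum_congr rfl fun e _ => by ring
    have : ∑ e, (ξ e : ℂ) * v (is e) =
        ∑ e, (ξ e : ℂ) * kv (is e) + ∑ e, (ξ e : ℂ) * h (is e) := by
      rw [hv1, ← Finset.sum_add_distrib]
      refine Finset.sum_congr rfl fun e _ => ?_
      simp only [Pi.add_apply]; ring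
    rw [this, hpair_k, hhΞ ξ hξ, add_zero]

variable (L cls κM) in
/-- **The Lie presentation of the family standard model `M` over `ℚ̄`, with the algebraic points
restricted to those with torsion abelian part**: kernel `ker(exp_M)`, `Alg := AlgTors`, and the
Lie algebras of the connected algebraic subgroups `H_{(A,C,Ξ)}`; the four axioms of
`LiePresentation` are PROVED (a family of lattices with algebraic invariants; the classification
of the algebraic subgroups behind `algLie` is the one valid for pairwise non-isogenous classes
whose CM classes carry at most one block, module docstring of `ManyCurveSemistable.lean`).
[folklore] -/
def presTors (hL : ∀ i, IsAlgebraic ℚ (L i).g₂ ∧ IsAlgebraic ℚ (L i).g₃) :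
    LiePresentation Kbar ℂ (β ⊕ (γ ⊕ δ)) where
  ker := kerSubgroup L cls κM
  Alg := AlgTors L cls κM
  algLie := algLie cls κM
  top_mem := ⟨SubgroupData.top cls κM, SubgroupData.tangent_top⟩
  bot_mem := ⟨SubgroupData.bot cls κM, SubgroupData.tangent_bot⟩
  isKRational_of_mem := by
    rintro _ ⟨D, rfl⟩
    exact D.isKRational_tangent
  torsion_mem := fun _ hk _ hm => torsion_mem_AlgTors hL hk hm
  mem_of_forall_exists := by
    rintro _ ⟨D, rfl⟩ v hv
    exact D.mem_tangent_of_forall_exists v fun m hm => hv m hm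

/-- `presTors` has kernel `ker`. [folklore] -/
@[simp] theorem mem_presTors_ker (hL : ∀ i, IsAlgebraic ℚ (L i).g₂ ∧ IsAlgebraic ℚ (L i).g₃)
    {w : β ⊕ (γ ⊕ δ) → ℂ} :
    w ∈ (presTors L cls κM hL).ker ↔ w ∈ ker L cls κM := Iff.rfl

/-- `presTors` has the algebraic subgroups `algLie`. [folklore] -/
@[simp] theorem presTors_algLie (hL : ∀ i, IsAlgebraic ℚ (L i).g₂ ∧ IsAlgebraic ℚ (L i).g₃) :
    (presTors L cls κM hL).algLie = algLie (β := β) cls κM := rfl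

/-- The algebraic points of `presTors`. [folklore] -/
@[simp] theorem presTors_Alg (hL : ∀ i, IsAlgebraic ℚ (L i).g₂ ∧ IsAlgebraic ℚ (L i).g₃) :
    (presTors L cls κM hL).Alg = AlgTors (β := β) L cls κM := rfl

/-- In the family standard model, `Semistable 𝔟` is `LiePresentation.Semistable` of `𝔟/0` in
`M` itself (`𝔥 = ⊥`). [folklore] -/
theorem semistable_iff_presTors (hL : ∀ i, IsAlgebraic ℚ (L i).g₂ ∧ IsAlgebraic ℚ (L i).g₃)
    (𝔟 : Submodule ℂ (β ⊕ (γ ⊕ δ) → ℂ)) :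
    Semistable cls κM 𝔟 ↔ (presTors L cls κM hL).Semistable ⊥ 𝔟 := by
  simp only [Semistable, LiePresentation.Semistable, presTors_algLie, bot_le, forall_true_left,
    finrank_bot, Nat.sub_zero]

end Discrete

end Std

end GaGmEFam

end Literature.NumberTheory.Transcendental

end
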